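import Summits.HodgeConjecture.HodgeCM.Model.Binders.IchinoExplicitLine_1

/-! PORT of `HodgeCM/Model/Binders/IchinoExplicitLine.lean` (HodgeCMPerL run 82) — part 2: continuation of `Summits.HodgeConjecture.HodgeCM.Model.Binders.IchinoExplicitLine_1` (split at a top-level declaration boundary by port_pkg.py; scope re-opened below; declarations unchanged). -/

-- port_pkg: scope re-opened for this part (file-level context, then the namespace/section stack open at the cut)
set_option autoImplicit false
noncomputable section
namespace HodgeCM
namespace Model
namespace Binders
namespace IchinoExplicitLine
open MvPolynomial Finsupp
open HodgeCM.PerL34.Fock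
open HodgeCM.Literature.Ichino2022 HodgeCM.Literature.Ichino2022.FockHarmonics
  HodgeCM.Literature.Ichino2022.HarmonicParam
section Dictionary
/-- The three admissible parameters of Lemma 7.10 at `(1,0;2,1)`: vacuum, `p⁺ = 1` with `a = (a₁)`, `p⁻ = 1` with
`b = (b₁)`; given as the single constructor used below. -/
def lineParam (S : SplittingDatum) (hp : S.p = 1) (hq : S.q = 0) (hr : S.r = 2) (hs : S.s = 1)
    (pp pm : ℕ) (hpp : pp + pm ≤ 1) (a : Fin pp → ℤ) (b : Fin pm → ℤ)
    (a_pos : ∀ i, 0 < a i) (b_neg : ∀ j, b j < 0) : HarmonicParam S where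
  pp := pp
  pm := pm
  qp := 0
  qm := 0
  a := a
  b := b
  c := Fin.elim0
  d := Fin.elim0
  a_anti := fun i j _ => by
    have : i = j := Fin.ext (by have := i.isLt; have := j.isLt; omega)
    rw [this]
  b_anti := fun i j _ => by
    have : i = j := Fin.ext (by have := i.isLt; have := j.isLt; omega)
    rw [this]
  c_anti := fun i => i.elim0
  d_anti := fun i => i.elim0
  a_pos := a_pos
  b_neg := b_neg
  c_pos := fun i => i.elim0
  d_neg := fun i => i.elim0
  hp := by omega
  hq := by omega
  hr := by omega
  hs := by omega

/-- **Ichino's Lemma 7.10 HOLDS in the explicit model `ℂ[z₁,z₂,w]` of `(U(1), U(2,1))`**, for every choice of the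
splitting exponents `(m₀, n₀)` carried by `S`. -/
theorem lemma_7_10_explicitLine (S : SplittingDatum) (hp : S.p = 1) (hq : S.q = 0) (hr : S.r = 2)
    (hs : S.s = 1) : (explicitLine S hr).Lemma_7_10 := by
  intro μ μ'
  rw [explicitLine_corresponds]
  constructor
  · rintro ⟨f, k, n₁, n₂, e, hf, hμ, h0, h1, h2⟩
    rcases (isHWVector_iff f k n₁ n₂ e).mp hf with
      ⟨a, c, -, -, rfl, rfl, rfl, rfl⟩ | ⟨d, c, hd, -, -, rfl, rfl, rfl, rfl⟩
    · -- `f = c z₁^a`: vacuum (`a = 0`) or `p⁺ = 1`, `a₁ = a`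
      by_cases ha : a = 0
      · subst ha
        refine ⟨lineParam S hp hq hr hs 0 0 (by omega) Fin.elim0 Fin.elim0 (fun i => i.elim0) (fun j => j.elim0),
          ?_, ?_⟩
        · ext i
          · rw [hμ i, mu_fst_apply, pad_mid _ _ _ _ (by show 0 ≤ i.val; omega) (by show i.val < S.p - 0; omega)]
            push_cast; ring
          · exact (Fin.cast hq i).elim0
        · ext i
          · have hi : i.val = 0 ∨ i.val = 1 := by have := i.isLt; omega
            rcases hi with hi | hi
            · have : i = ⟨0, by omega⟩ := Fin.ext hi
              rw [this, h0, mu'_fst_apply, pad_mid _ _ _ _ (by show 0 ≤ 0; omega) (by show 0 < S.r - 0; omega)]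
              push_cast; ring
            · have : i = ⟨1, by omega⟩ := Fin.ext hi
              rw [this, h1, mu'_fst_apply, pad_mid _ _ _ _ (by show 0 ≤ 1; omega) (by show 1 < S.r - 0; omega)]
              push_cast; ring
          · rw [h2 i, mu'_snd_apply, pad_mid _ _ _ _ (by show 0 ≤ i.val; omega) (by show i.val < S.s - 0; omega)]
            push_cast; ring
      · have ha1 : 0 < (a : ℤ) := by omega
        refine ⟨lineParam S hp hq hr hs 1 0 (by omega) (fun _ => a) Fin.elim0 (fun _ => ha1) (fun j => j.elim0),
          ?_, ?_⟩
        · ext i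
          · rw [hμ i, mu_fst_apply, pad_head _ _ _ _ (by show i.val < 1; omega)]
            simp only [lineParam]
          · exact (Fin.cast hq i).elim0
        · ext i
          · have hi : i.val = 0 ∨ i.val = 1 := by have := i.isLt; omega
            rw [mu'_fst_apply]
            rcases hi with hi | hi
            · have : i = ⟨0, by omega⟩ := Fin.ext hi
              rw [this, h0, pad_head _ _ _ _ (by show 0 < 1; omega)]
              simp only [lineParam]
            · have : i = ⟨1, by omega⟩ := Fin.ext hi
              rw [this, h1, pad_mid _ _ _ _ (by show 1 ≤ 1; omega) (by show 1 < S.r - 0; omega)]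
              push_cast; ring
          · rw [h2 i, mu'_snd_apply, pad_mid _ _ _ _ (by show 0 ≤ i.val; omega)
              (by show i.val < S.s - 0; omega)]
            push_cast; ring
    · -- `f = c w^d`: `p⁻ = 1`, `b₁ = −d`
      have hd' : (-(d : ℤ)) < 0 := by omega
      refine ⟨lineParam S hp hq hr hs 0 1 (by omega) Fin.elim0 (fun _ => -(d : ℤ)) (fun i => i.elim0)
        (fun _ => hd'), ?_, ?_⟩
      · ext i
        · rw [hμ i, mu_fst_apply, pad_tail _ _ _ _ (by show 0 ≤ i.val; omega) (by show S.p - 1 ≤ i.val; omega)]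
          simp only [lineParam]
        · exact (Fin.cast hq i).elim0
      · ext i
        · rw [mu'_fst_apply, pad_mid _ _ _ _ (by show 0 ≤ i.val; omega) (by show i.val < S.r - 0; omega)]
          have hi : i.val = 0 ∨ i.val = 1 := by have := i.isLt; omega
          rcases hi with hi | hi
          · have : i = ⟨0, by omega⟩ := Fin.ext hi
            rw [this, h0]; push_cast; ring
          · have : i = ⟨1, by omega⟩ := Fin.ext hi
            rw [this, h1]; push_cast; ring
        · rw [h2 i, mu'_snd_apply, pad_tail _ _ _ _ (by show 0 ≤ i.val; omega) (by show S.s - 1 ≤ i.val; omega)]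
          simp only [lineParam]
          push_cast; ring
  · rintro ⟨P, hμ, hμ'⟩
    have hPq : P.qp + P.qm ≤ S.q := P.hq
    have hPs : P.pm + P.qp ≤ S.s := P.hs
    have hPp : P.pp + P.pm ≤ S.p := P.hp
    have hqm : P.qm = 0 := by omega
    have hqp : P.qp = 0 := by omega
    rcases Nat.lt_or_ge 0 P.pp with hpp | hpp
    · -- `p⁺ = 1`: the vector `z₁^{a₁}`
      have hpm : P.pm = 0 := by omega
      have ha := P.a_pos ⟨0, hpp⟩
      refine ⟨_, _, _, _, _, (isHWVector_iff _ _ _ _ _).mpr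
        (Or.inl ⟨(P.a ⟨0, hpp⟩).toNat, 1, one_ne_zero, rfl, rfl, rfl, rfl, rfl⟩), ?_, ?_, ?_, ?_⟩
      · intro i
        rw [hμ, mu_fst_apply, pad_head _ _ _ _ (by omega)]
        have : P.a ⟨i.val, by omega⟩ = P.a ⟨0, hpp⟩ := by congr 1; exact Fin.ext (by have := i.isLt; omega)
        rw [this]
        have : (((P.a ⟨0, hpp⟩).toNat : ℤ) : ℚ) = (P.a ⟨0, hpp⟩ : ℚ) := by
          exact_mod_cast Int.toNat_of_nonneg ha.le
        rw [this]
      · rw [hμ', mu'_fst_apply, pad_head _ _ _ _ (by simp; omega)]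
        have : (((P.a ⟨0, hpp⟩).toNat : ℤ) : ℚ) = (P.a ⟨0, hpp⟩ : ℚ) := by
          exact_mod_cast Int.toNat_of_nonneg ha.le
        rw [this]
      · rw [hμ', mu'_fst_apply, pad_mid _ _ _ _ (by simp; omega) (by simp; omega)]
        push_cast; ring
      · intro j
        rw [hμ', mu'_snd_apply, pad_mid _ _ _ _ (by omega) (by have := j.isLt; omega)]
        push_cast; ring
    · rcases Nat.lt_or_ge 0 P.pm with hpm | hpm
      · -- `p⁻ = 1`: the vector `w^{−b₁}`
        have hb := P.b_neg ⟨0, hpm⟩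
        have hd : 1 ≤ (-(P.b ⟨0, hpm⟩)).toNat := by omega
        refine ⟨_, _, _, _, _, (isHWVector_iff _ _ _ _ _).mpr
          (Or.inr ⟨(-(P.b ⟨0, hpm⟩)).toNat, 1, hd, one_ne_zero, rfl, rfl, rfl, rfl, rfl⟩), ?_, ?_, ?_, ?_⟩
        · intro i
          rw [hμ, mu_fst_apply, pad_tail _ _ _ _ (by omega) (by have := i.isLt; omega)]
          have : P.b ⟨i.val - (S.p - P.pm), by omega⟩ = P.b ⟨0, hpm⟩ := by
            congr 1; exact Fin.ext (by have := i.isLt; simp; omega)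
          rw [this]
          have hcast : (((-(P.b ⟨0, hpm⟩)).toNat : ℕ) : ℚ) = -((P.b ⟨0, hpm⟩ : ℤ) : ℚ) := by
            exact_mod_cast Int.toNat_of_nonneg (by omega : (0:ℤ) ≤ -(P.b ⟨0, hpm⟩))
          push_cast
          rw [hcast]; ring
        · rw [hμ', mu'_fst_apply, pad_mid _ _ _ _ (by simp; omega) (by simp; omega)]
          push_cast; ring
        · rw [hμ', mu'_fst_apply, pad_mid _ _ _ _ (by simp; omega) (by simp; omega)]
          push_cast; ring
        · intro j
          rw [hμ', mu'_snd_apply, pad_tail _ _ _ _ (by omega) (by have := j.isLt; omega)]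
          have : P.b ⟨j.val - (S.s - P.pm), by have := j.isLt; omega⟩ = P.b ⟨0, hpm⟩ := by
            congr 1; exact Fin.ext (by have := j.isLt; simp; omega)
          rw [this]
          have hcast : (((-(P.b ⟨0, hpm⟩)).toNat : ℕ) : ℚ) = -((P.b ⟨0, hpm⟩ : ℤ) : ℚ) := by
            exact_mod_cast Int.toNat_of_nonneg (by omega : (0:ℤ) ≤ -(P.b ⟨0, hpm⟩))
          push_cast
          rw [hcast]; ring
      · -- the vacuum: the constant `1 = z₁^0`
        have hpp0 : P.pp = 0 := by omega
        have hpm0 : P.pm = 0 := by omega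
        refine ⟨_, _, _, _, _, (isHWVector_iff _ _ _ _ _).mpr
          (Or.inl ⟨0, 1, one_ne_zero, rfl, rfl, rfl, rfl, rfl⟩), ?_, ?_, ?_, ?_⟩
        · intro i
          rw [hμ, mu_fst_apply, pad_mid _ _ _ _ (by omega) (by have := i.isLt; omega)]
          push_cast; ring
        · rw [hμ', mu'_fst_apply, pad_mid _ _ _ _ (by simp; omega) (by simp; omega)]
          push_cast; ring
        · rw [hμ', mu'_fst_apply, pad_mid _ _ _ _ (by simp; omega) (by simp; omega)]
          push_cast; ring
        · intro j
          rw [hμ', mu'_snd_apply, pad_mid _ _ _ _ (by omega) (by have := j.isLt; omega)]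
          push_cast; ring

end Dictionary

/-! ## §4 Junction with PerL's `J⁺`-piece (pv12 `FockKTypes`, hQ's `QautFockBridge`) -/

/-- **The harmonic highest-weight line of `U(W)`-weight `1` IS the lowest-`K`-type line `ℂ·z₁` of the `J⁺`-piece**:
Ichino's harmonic datum `(k; n₁, n₂; e) = (1; 1, 0; 0)` (the parameter `a₁ = 1` of Lemma 7.10, paired with
`𝔭₊ = (1,0;−1)` after the shifts) is carried exactly by the multiples of `z₁` — pv12's `jplus_lowest` line
("the harmonic `z₁` generating `J⁺`", PerL v5 l. 475; the lowest `K_{ι₁}`-type of hQ's `QautFockBridge`). -/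
theorem isHWVector_weight_one_iff (f : HarmModel) (n₁ n₂ e : ℤ) :
    IsHWVector f 1 n₁ n₂ e ↔ (n₁ = 1 ∧ n₂ = 0 ∧ e = 0) ∧ ∃ c : ℂ, c ≠ 0 ∧ f = c • hz 0 := by
  rw [isHWVector_iff]
  constructor
  · rintro (⟨a, c, hc, hf, hk, h1, h2, h3⟩ | ⟨d, c, hd, hc, hf, hk, -, -, -⟩)
    · have ha : a = 1 := by omega
      subst ha
      exact ⟨⟨h1, h2, h3⟩, c, hc, by rw [hf, pow_one]⟩
    · omega
  · rintro ⟨⟨rfl, rfl, rfl⟩, c, hc, rfl⟩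
    exact Or.inl ⟨1, c, hc, by rw [pow_one], by norm_num, by norm_num, rfl, rfl⟩

/-- The same line in pv12's vocabulary: a NON-ZERO vector of the `J⁺`-piece (`InJplus`: `U(W)`-weight one) killed by
`E₊` with first row-weight `1` is a harmonic joint highest-weight vector of weights `(1; 1, 0; 0)`, and conversely. -/
theorem isHWVector_one_iff_jplus_lowest (f : HarmModel) :
    IsHWVector f 1 1 0 0 ↔
      f ≠ 0 ∧ InJplus f ∧ hEplus f = 0 ∧ weightOp (hrowWt 0) f = (((1 : ℕ) : ℤ) : ℂ) • f := by
  rw [isHWVector_weight_one_iff, (jplus_lowest f).2]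
  constructor
  · rintro ⟨-, c, hc, rfl⟩
    refine ⟨?_, c, rfl⟩
    rw [hz]
    exact smul_ne_zero hc (X_ne_zero _)
  · rintro ⟨hne, c, rfl⟩
    refine ⟨⟨rfl, rfl, rfl⟩, c, ?_, rfl⟩
    rintro rfl
    exact hne (zero_smul _ _)

/-! ## §5 Group-level form of the weight conditions (the bridge requested by W3-B, STATUS 18:17:05Z) -/

/-- `weightOp` eigen-equations are weighted homogeneity (Mathlib `IsWeightedHomogeneous`), over `ℂ`. -/
theorem weightOp_eq_smul_iff_isWeightedHomogeneous {σ : Type*} [Fintype σ] [DecidableEq σ] (s : σ → ℤ)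
    (f : MvPolynomial σ ℂ) (n : ℤ) : weightOp s f = (n : ℂ) • f ↔ IsWeightedHomogeneous s f n := by
  have hwt : ∀ m : σ →₀ ℕ, wt s m = weight s m := by
    intro m
    rw [wt, weight_apply, Finsupp.sum_fintype _ _ (by simp)]
    exact Finset.sum_congr rfl fun i _ => by rw [nsmul_eq_mul, mul_comm]
  constructor
  · intro h m hm
    rw [← hwt]
    exact wt_eq_of_weightOp_eq_smul h (MvPolynomial.mem_support_iff.mpr hm)
  · intro h
    ext m
    rw [coeff_weightOp, coeff_smul, smul_eq_mul]
    by_cases hc : coeff m f = 0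
    · rw [hc, mul_zero, mul_zero]
    · rw [hwt, h hc]

/-- **The bridge to a UNITARY torus acting by characters**: a `weightOp s`-eigenvector with eigenvalue `n` is the
same as a vector on which every unit-circle element of the diagonal torus `X_i ↦ u^{s_i} X_i`
(`TorusScaling.torusAct s u`) acts by `u^n`.  Apply with `s = uWt`, `hrowWt a`, `hwWt` to read the four weight fields of
`IsHWVector` off a constructed unitary representation (W3-B's `fockRep`/`schrodingerU` torus elements). -/
theorem weightOp_eq_smul_iff_torusAct {σ : Type*} [Fintype σ] [DecidableEq σ] (s : σ → ℤ)
    (f : MvPolynomial σ ℂ) (n : ℤ) :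
    weightOp s f = (n : ℂ) • f ↔
      ∀ u : ℂˣ, ‖(u : ℂ)‖ = 1 → TorusScaling.torusAct s u f = ((u ^ n : ℂˣ) : ℂ) • f := by
  rw [weightOp_eq_smul_iff_isWeightedHomogeneous, TorusScaling.isWeightedHomogeneous_iff_torusAct]

end IchinoExplicitLine
end Binders
end Model
end HodgeCM

-- port_pkg: scope closed for this part
end
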